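import Summits.NavierStokesRegularity.NavierStokesRegularity.Theorems.TerminalTraceTypeITraceScarL3LayerDecayPressureOsc
import Summits.NavierStokesRegularity.NavierStokesRegularity.Theorems.TerminalTraceTypeITraceScarL3GaugedPressure
import Summits.NavierStokesRegularity.NavierStokesRegularity.Theorems.TerminalTraceTypeITraceScarL3StubExtinctApexOfL3Trace

set_option linter.dupNamespace false

/-!
# The terminal-layer criterion of item 18385 (ROUND-33) with the pressure class DISCHARGED

Plate t34 of nsreg-p2 g30 (`…LayerDecaySubTypeI.lean`, `…LayerDecay.lean`, `…LayerDecayPressureOsc.lean`)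
proves item `TerminalTrace.TypeITraceScarL3` (stmt-NavierStokesRegularity-18385) at unit viscosity in
the class {(a) one-sided Lipschitz companion / (a′) scaled pressure oscillation, (b) terminal-layer
decay below `√σ`, (c) the printed pressure class `p ∈ L^{3/2}(Q_R(T,x₀))`}.  Clause (c) is an artefact
of the item quantifying over a classical pressure `p` (determined only up to `c(t)`, which may leave
`L^{3/2}` near `T`).  This file deletes (c): the ε-regularity inputs of the plate (Seregin's scaled
energies bound `scaledEnergies_bounded_of_typeIRate` and the cubic floor
`Seregin2020.exists_le_cknC_of_isBackwardSingularPoint`) are statements about SUITABLE WEAK pairs on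
the cylinder, and we feed them `(u, q)` with Tao's gauged pressure `q = p − (p(t,0) − p̃[u(t)](0))`
(`gaugedPressure_suitable_and_memLp`: `(u,q)` suitable on `Q_r(T,x₀)` and `q ∈ L^{3/2}(Q_r(T,x₀))`
for every `r² ≤ T`, from the tree's `SereginSverak2002.isSuitableWeakSolutionOn_gauge_of_classical` /
`lintegral_slab_gauged_pressure_lt_top`).  Everything else is the plate's proof verbatim, organised around a backward-boundedness core:

* `isBackwardBoundedAt_of_terminalLayerDecay_unit` — (a) ∧ (b) at `x₀` ⇒ `u` backward bounded at
  `(T,x₀)` (hypotheses: classical + Leray–Hopf + Type I only; the form consumed by the ν-scaling sequel);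
* `typeITraceScarL3_unitViscosity_of_terminalLayerDecay` — item-shaped, class (a) ∧ (b) only;
* `typeITraceScarL3_unitViscosity_of_terminalLayerDecay_of_pressureOsc` — class (a′) ∧ (b) only
  ((a′) is itself invariant under `p ↦ p + c(t)`, so no clause on the gauge of `p` remains).

Type I is used as in the plate (Morrey bound, rate window, Seregin's Prop. 3.11 (i); plus the
Lipschitz companion in the `_of_pressureOsc` form).  `ν = 1` only, as in the plate.
-/

noncomputable section

open MeasureTheory Set Function Metric Filter Topology Literature.Analysis.FluidPDE
open scoped ENNReal NNReal

namespace Summit.NavierStokesRegularity.NavierStokesRegularity.Theorems.TypeITraceScarL3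

/-- **Core of the terminal-layer criterion (unit viscosity), backward-boundedness form, no pressure
clause.**  For a classical solution `(u,p)` on `[0,T)`, Leray–Hopf on `[0,T)` and Type I in time, if at
`x₀` the one-sided Lipschitz companion (a) holds on `B(x₀,ρ) × B(x₀,2ρ)` for `t ∈ (T₀,T)` and the
terminal-layer dial (b) «∀ ε > 0 ∃ τ ∈ (0,1] ∃ l₁ > 0 ∀ l ≤ l₁ ∀ x ∈ B(x₀,ρ),
∫_{B(x,l)}|u(T−τ²l²)|² ≤ ε τ l» holds, then `u` is backward bounded at `(T,x₀)`.  The ε-regularity inputs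
(Seregin's scaled-energies bound and cubic floor) are fed the pair `(u, q)`, `q` = Tao's gauged pressure
(`gaugedPressure_suitable_and_memLp`), so the printed pressure class is met with no clause on `p`.  Proof =
plate t34's Thm C (nsreg-p2 g30) by contradiction: a classical solution that is not backward bounded at
`(T,x₀)` is backward singular there in the essential-sup sense (continuity below `T`).
[cite: Seregin2014, Ch. 6 Prop. 3.11 (i); Seregin2020, (2.9); Tao2011, Lemma 4.1 (i)] -/
theorem isBackwardBoundedAt_of_terminalLayerDecay_unit {T : ℝ} (hT : 0 < T)
    {u : ℝ → (EuclideanSpace ℝ (Fin 3)) → (EuclideanSpace ℝ (Fin 3))}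
    {p : ℝ → (EuclideanSpace ℝ (Fin 3)) → ℝ}
    (hcl : IsClassicalNSSolutionOn (Set.Ico 0 T) 1 0 u p) (hLH : IsLerayHopfOn T 1 0 (u 0) u)
    (hTI : IsTypeIBlowup u T) {x₀ : EuclideanSpace ℝ (Fin 3)} {ρ Cg T₀ : ℝ} (hρ : 0 < ρ) (hCg : 0 < Cg)
    (hT₀ : T₀ < T)
    (hlip : ∀ t ∈ Ioo T₀ T, ∀ x ∈ ball x₀ ρ, ∀ y ∈ ball x₀ (2 * ρ),
      ‖u t x‖ - ‖u t y‖ ≤ Cg / (T - t) * dist y x)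
    (hlayer : ∀ ε : ℝ, 0 < ε → ∃ τ : ℝ, 0 < τ ∧ τ ≤ 1 ∧ ∃ l₁ : ℝ, 0 < l₁ ∧
      ∀ l : ℝ, 0 < l → l ≤ l₁ → ∀ x ∈ ball x₀ ρ,
        ∫⁻ y in ball x l, ‖u (T - τ ^ 2 * l ^ 2) y‖ₑ ^ 2 ≤ ENNReal.ofReal (ε * τ * l)) :
    IsBackwardBoundedAt u T x₀ := by
  by_contra hnotbd
  -- a classical solution that is not backward bounded at `(T,x₀)` is backward singular there in the
  -- essential-sup sense: an essential bound on an open cylinder is an everywhere bound by continuity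
  have hsing : ∀ r : ℝ, 0 < r →
      eLpNorm (Function.uncurry u) ⊤ (volume.restrict (parabolicCylinder r (T, x₀))) = ⊤ := by
    intro r hr
    by_contra hne
    apply hnotbd
    have hlt : eLpNorm (Function.uncurry u) ⊤ (volume.restrict (parabolicCylinder r (T, x₀))) < ⊤ :=
      lt_top_iff_ne_top.2 hne
    set Kₑ : ℝ≥0∞ := eLpNorm (Function.uncurry u) ⊤ (volume.restrict (parabolicCylinder r (T, x₀)))
      with hKₑ
    have hae : ∀ᵐ z ∂(volume.restrict (parabolicCylinder r ((T : ℝ), x₀))),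
        ‖Function.uncurry u z‖ ≤ Kₑ.toReal := by
      have h1 := ae_le_eLpNormEssSup (μ := volume.restrict (parabolicCylinder r ((T : ℝ), x₀)))
        (f := Function.uncurry u)
      filter_upwards [h1] with z hz
      rw [← eLpNorm_exponent_top] at hz
      have hz' : (‖Function.uncurry u z‖₊ : ℝ≥0∞) ≤ Kₑ := hz
      have := ENNReal.toReal_mono hlt.ne hz'
      simpa using this
    -- the cylinder below `T` with `r² ≤ T` part: shrink to `r' = min r (√T)` so that it lies in `[0,T) × ℝ³`
    set r' : ℝ := min r (Real.sqrt T) with hr'_def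
    have hr' : 0 < r' := lt_min hr (Real.sqrt_pos.2 hT)
    have hr'r : r' ≤ r := min_le_left _ _
    have hr'T : r' ^ 2 ≤ T := by
      have h1 : r' ≤ Real.sqrt T := min_le_right _ _
      calc r' ^ 2 ≤ (Real.sqrt T) ^ 2 := pow_le_pow_left₀ hr'.le h1 2
        _ = T := Real.sq_sqrt hT.le
    have hsubc : parabolicCylinder r' ((T : ℝ), x₀) ⊆ Set.Ico 0 T ×ˢ (univ : Set (EuclideanSpace ℝ (Fin 3))) :=
      (parabolicCylinder_top_subset_openSlab hr'T x₀).trans (prod_mono Ioo_subset_Ico_self subset_rfl)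
    have hcont : ContinuousOn (Function.uncurry u) (parabolicCylinder r' ((T : ℝ), x₀)) :=
      hcl.smooth_velocity.continuousOn.mono hsubc
    have hae' : ∀ᵐ z ∂(volume.restrict (parabolicCylinder r' ((T : ℝ), x₀))),
        ‖Function.uncurry u z‖ ≤ Kₑ.toReal :=
      ae_restrict_of_ae_restrict_of_subset (parabolicCylinder_mono hr'.le hr'r _) hae
    have hpt := SereginSverak2002.norm_le_of_ae_restrict_of_continuousOn
      (isOpen_parabolicCylinder r' ((T : ℝ), x₀)) hcont hae'
    refine ⟨r', hr', Kₑ.toReal, fun t ht x hx => ?_⟩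
    have hz : ((t, x) : ℝ × EuclideanSpace ℝ (Fin 3)) ∈ parabolicCylinder r' ((T : ℝ), x₀) := by
      rw [mem_parabolicCylinder]; exact ⟨ht, mem_ball.1 hx⟩
    exact hpt (t, x) hz
  -- (0) no pressure class is assumed: any scale `R` with `R² ≤ T` will do (Tao's gauge below)
  obtain ⟨R, hR, hRT⟩ : ∃ R : ℝ, 0 < R ∧ R ^ 2 ≤ T :=
    ⟨Real.sqrt T, Real.sqrt_pos.2 hT, (Real.sq_sqrt hT.le).le⟩
  -- (1) locally sub-Type-I at `x₀` (the dial below `√σ`)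
  have hsub := subTypeI_of_layerDecay hρ hCg hT₀ hlip hlayer
  -- (2) the Type-I rate window and the Morrey bound (Type I used)
  obtain ⟨C, δ, hC0, hδ, hδT, hrate⟩ := exists_typeI_rate_window hT hTI
  obtain ⟨rM, M₀, TM, hrM, hTM, hmorB⟩ := morrey_of_typeI one_pos hT hcl hLH hTI
  set M : ℝ := max M₀ 0 with hM_def
  have hM0 : 0 ≤ M := le_max_right _ _
  have hmor : ∀ t ∈ Ioo TM T, 0 ≤ t → ∀ r : ℝ, 0 < r → r ≤ rM →
      ∫⁻ x in ball x₀ r, ‖u t x‖ₑ ^ 2 ≤ ENNReal.ofReal (M * r) := by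
    intro t ht ht0 r hr hrr
    rw [lintegral_ball_enorm_sq_eq_ofReal (hLH.memLp t ⟨ht0, ht.2.le⟩)]
    refine ENNReal.ofReal_le_ofReal ((hmorB t ht x₀ r hr hrr).trans ?_)
    exact mul_le_mul_of_nonneg_right (le_max_left _ _) hr.le
  -- (3) the working radius `r₀`
  set W : ℝ := min δ (T - TM) with hW_def
  have hW : 0 < W := lt_min hδ (sub_pos.2 hTM)
  set r₀ : ℝ := min (min R rM) (Real.sqrt W / 2) with hr₀_def
  have hr₀ : 0 < r₀ := lt_min (lt_min hR hrM) (by positivity)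
  have hr₀R : r₀ ≤ R := (min_le_left _ _).trans (min_le_left _ _)
  have hr₀M : r₀ ≤ rM := (min_le_left _ _).trans (min_le_right _ _)
  have hr₀W : r₀ ^ 2 < W := by
    have h1 : r₀ ≤ Real.sqrt W / 2 := min_le_right _ _
    have h2 : (Real.sqrt W) ^ 2 = W := Real.sq_sqrt hW.le
    nlinarith [Real.sqrt_nonneg W]
  have hr₀δ : r₀ ^ 2 < δ := hr₀W.trans_le (min_le_left _ _)
  have hr₀TM : TM < T - r₀ ^ 2 := by linarith [min_le_right δ (T - TM)]
  have hr₀T : r₀ ^ 2 ≤ T := (hr₀δ.le.trans hδT)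
  -- (4) the suitable weak solution on `Q₀ = Q_{r₀}(T,x₀)` (unit viscosity), its weak gradient
  have hsubQ : parabolicCylinder r₀ (T, x₀) ⊆ Set.Ico 0 T ×ˢ (univ : Set (EuclideanSpace ℝ (Fin 3))) := by
    intro z hz
    rw [mem_parabolicCylinder] at hz
    refine mem_prod.2 ⟨⟨?_, hz.1.2⟩, mem_univ _⟩
    have h1 : T - r₀ ^ 2 < z.1 := hz.1.1
    linarith
  -- Tao's gauge `q = p − (p(t,0) − p̃[u(t)](0))`: `(u, q)` is a suitable weak solution on
  -- `Q_{r₀}(T,x₀)` and `q ∈ L^{3/2}(Q_{r₀}(T,x₀))` (tree: `gaugedPressure_suitable_and_memLp`)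
  obtain ⟨hsw, hpL⟩ := gaugedPressure_suitable_and_memLp one_pos hT hcl hLH x₀ hr₀T
  set q : ℝ → (EuclideanSpace ℝ (Fin 3)) → ℝ := fun t x => p t x - (p t 0 - normalisedPressure (u t) 0)
    with hq_def
  have hQ₀ : parabolicCylinder r₀ (T, x₀) ⊆
      ((parabolicCylinderOpens r₀ (T, x₀) : TopologicalSpace.Opens (ℝ × (EuclideanSpace ℝ (Fin 3)))) : Set (ℝ × (EuclideanSpace ℝ (Fin 3)))) := by
    rw [coe_parabolicCylinderOpens]
  obtain ⟨G, hGslab, -, hGint, -⟩ := hLH.exists_hasWeakSpatialGradientOn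
  have hQslab : parabolicCylinder r₀ (T, x₀) ⊆ Ioo 0 T ×ˢ (univ : Set (EuclideanSpace ℝ (Fin 3))) := by
    intro z hz
    rw [mem_parabolicCylinder] at hz
    refine mem_prod.2 ⟨⟨?_, hz.1.2⟩, mem_univ _⟩
    have h1 : T - r₀ ^ 2 < z.1 := hz.1.1
    linarith
  have hG : HasWeakSpatialGradientOn (parabolicCylinderOpens r₀ (T, x₀)) u G :=
    hGslab.mono (fun z hz => mem_slab.2 (mem_prod.1 (hQslab hz)).1)
  -- (5) finiteness at scale `r₀`: `D` of the gauged pressure, `C` from Type I + Morrey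
  have hDfin : cknD r₀ (T, x₀) q < ⊤ := by
    rw [cknD]
    refine ENNReal.mul_lt_top
      (ENNReal.inv_lt_top.2 (ENNReal.pow_pos (ENNReal.ofReal_pos.2 hr₀) _)) ?_
    have h32 : ((3 : ℝ≥0∞) / 2).toReal = (3 / 2 : ℝ) := by
      rw [ENNReal.toReal_div]; norm_num
    have hI := lintegral_rpow_enorm_lt_top_of_eLpNorm_lt_top (by norm_num)
      (ENNReal.div_lt_top (by norm_num) (by norm_num)).ne hpL.2
    rw [h32] at hI
    simpa [Function.uncurry] using hI
  have hmeasQ : ∀ r : ℝ, 0 < r → r ≤ r₀ → AEMeasurable (fun w : ℝ × (EuclideanSpace ℝ (Fin 3)) => ‖u w.1 w.2‖ₑ ^ (3 : ℕ))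
      (volume.restrict (parabolicCylinder r (T, x₀))) := by
    intro r hr hrr
    have hu : AEStronglyMeasurable (uncurry u) (volume.restrict (parabolicCylinder r (T, x₀))) :=
      hsw.distributional.1.aestronglyMeasurable.mono_measure
        (Measure.restrict_mono ((parabolicCylinder_mono hr.le hrr _).trans hQ₀) le_rfl)
    exact (hu.enorm.pow_const 3 : AEMeasurable (fun w : ℝ × (EuclideanSpace ℝ (Fin 3)) => ‖uncurry u w‖ₑ ^ (3 : ℕ)) _)
  have hrateQ : ∀ r : ℝ, 0 < r → r ≤ r₀ → ∀ t ∈ Ioo (T - r ^ 2) T, ∀ x ∈ ball x₀ r,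
      Real.sqrt (T - t) * ‖u t x‖ ≤ C := by
    intro r hr hrr t ht x _
    refine hrate t ⟨?_, ht.2⟩ x
    have : r ^ 2 ≤ r₀ ^ 2 := pow_le_pow_left₀ hr.le hrr 2
    linarith [ht.1]
  have hmorQ : ∀ r : ℝ, 0 < r → r ≤ r₀ → ∀ᵐ t ∂(volume.restrict (Ioo (T - r ^ 2) T)),
      ∫⁻ x in ball x₀ r, ‖u t x‖ₑ ^ 2 ≤ ENNReal.ofReal (M * r) := by
    intro r hr hrr
    filter_upwards [ae_restrict_mem measurableSet_Ioo] with t ht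
    have : r ^ 2 ≤ r₀ ^ 2 := pow_le_pow_left₀ hr.le hrr 2
    exact hmor t ⟨by linarith [ht.1], ht.2⟩ (by linarith [ht.1]) r hr (hrr.trans hr₀M)
  have hCfin : cknC r₀ (T, x₀) u < ⊤ :=
    lt_of_le_of_lt (cknC_le_of_rate_of_morrey hr₀ hC0 hM0 (hmeasQ r₀ hr₀ le_rfl)
      (hrateQ r₀ hr₀ le_rfl) (hmorQ r₀ hr₀ le_rfl)) ENNReal.ofReal_lt_top
  -- (6) Seregin 2014 Prop. 3.11 (i): the Type-I rate bounds `A + E + C + D` on `Q_r`, `r < r₀/2`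
  have hI' : ∃ c : ℝ, ∀ᵐ w ∂(volume.restrict (parabolicCylinder r₀ (T, x₀))),
      Real.sqrt ((T, x₀).1 - w.1) * ‖u w.1 w.2‖ ≤ c := by
    refine ⟨C, (ae_restrict_mem (isOpen_parabolicCylinder r₀ (T, x₀)).measurableSet).mono fun w hw => ?_⟩
    rw [mem_parabolicCylinder] at hw
    exact hrate w.1 ⟨by linarith [hw.1.1], hw.1.2⟩ w.2
  obtain ⟨K, hK⟩ := scaledEnergies_bounded_of_typeIRate hsw hG hr₀ hQ₀ hCfin.ne hDfin.ne hI'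
  -- (7) Seregin's cubic floor at the backward singular point `(T,x₀)` with `L := K`
  set r₁ : ℝ := r₀ / 4 with hr₁_def
  have hr₁ : 0 < r₁ := by positivity
  have hr₁h : r₁ < r₀ / 2 := by rw [hr₁_def]; linarith
  have hr₁r₀ : r₁ ≤ r₀ := by rw [hr₁_def]; linarith
  have hK₁ := hK r₁ ⟨hr₁, hr₁h⟩
  have hA₁ : cknAEss r₁ (T, x₀) u ≠ ⊤ :=
    ne_top_of_le_ne_top ENNReal.coe_ne_top
      ((le_add_of_nonneg_right (by positivity)).trans
        ((le_add_of_nonneg_right (by positivity)).trans ((le_add_of_nonneg_right (by positivity)).trans hK₁)))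
  have hE₁ : cknE r₁ (T, x₀) G ≠ ⊤ := by
    refine ne_top_of_le_ne_top ENNReal.coe_ne_top (le_trans ?_ hK₁)
    calc cknE r₁ (T, x₀) G ≤ cknAEss r₁ (T, x₀) u + cknE r₁ (T, x₀) G := le_add_self
      _ ≤ cknAEss r₁ (T, x₀) u + cknE r₁ (T, x₀) G + cknC r₁ (T, x₀) u := le_self_add
      _ ≤ _ := le_self_add
  have hD₁ : ∀ r ∈ Ioc (0 : ℝ) r₁, cknD r (T, x₀) q ≤ (K : ℝ≥0∞) := by
    intro r hr
    exact le_trans le_add_self (hK r ⟨hr.1, lt_of_le_of_lt hr.2 hr₁h⟩)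
  have hsing' : IsBackwardSingularPoint u (T, x₀) := fun r hr => hsing r hr
  obtain ⟨κ, hκ, Hfloor⟩ := Seregin2020.exists_le_cknC_of_isBackwardSingularPoint K
  have hfloor := Hfloor _ u q G hsw hG (T, x₀) r₁ hr₁
    ((parabolicCylinder_mono hr₁.le hr₁r₀ _).trans hQ₀) hA₁ hE₁ hD₁ hsing'
  -- (8) turn the dial: `ε_g` with `2 ε_g M < κ`
  set εg : ℝ := κ / (4 * (M + 1)) with hεg_def
  have hεg : 0 < εg := by positivity
  have hεgM : 2 * εg * M < κ := by
    rw [hεg_def]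
    have hM1 : 0 < M + 1 := by linarith
    have : 2 * (κ / (4 * (M + 1))) * M = κ * (M / (M + 1)) / 2 := by field_simp; ring
    rw [this]
    have hfrac : M / (M + 1) < 1 := by rw [div_lt_one hM1]; linarith
    nlinarith [mul_lt_mul_of_pos_left hfrac hκ]
  obtain ⟨T₁, hT₁, hsmall⟩ := hsub εg hεg
  set W₁ : ℝ := T - T₁ with hW₁_def
  have hW₁ : 0 < W₁ := sub_pos.2 hT₁
  set r : ℝ := min (min r₁ ρ) (Real.sqrt W₁ / 2) with hr_def
  have hr : 0 < r := lt_min (lt_min hr₁ hρ) (by positivity)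
  have hrr₁ : r ≤ r₁ := (min_le_left _ _).trans (min_le_left _ _)
  have hrρ : r ≤ ρ := (min_le_left _ _).trans (min_le_right _ _)
  have hrr₀ : r ≤ r₀ := hrr₁.trans hr₁r₀
  have hrW₁ : r ^ 2 < W₁ := by
    have h1 : r ≤ Real.sqrt W₁ / 2 := min_le_right _ _
    have h2 : (Real.sqrt W₁) ^ 2 = W₁ := Real.sq_sqrt hW₁.le
    nlinarith [Real.sqrt_nonneg W₁]
  -- `C(r) ≤ 2 ε_g M` from the sub-Type-I bound and Morrey
  have hsupr : ∀ t ∈ Ioo (T - r ^ 2) T, ∀ x ∈ ball x₀ r, Real.sqrt (T - t) * ‖u t x‖ ≤ εg := by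
    intro t ht x hx
    exact hsmall t ⟨by linarith [ht.1], ht.2⟩ x (ball_subset_ball hrρ hx)
  have hCle : cknC r (T, x₀) u ≤ ENNReal.ofReal (2 * εg * M) :=
    cknC_le_of_rate_of_morrey hr hεg.le hM0 (hmeasQ r hr hrr₀) hsupr (hmorQ r hr hrr₀)
  -- against the floor `κ ≤ C(r)`
  have hge : ENNReal.ofReal κ ≤ cknC r (T, x₀) u := hfloor r ⟨hr, hrr₁⟩
  have : κ ≤ 2 * εg * M := (ENNReal.ofReal_le_ofReal_iff (by positivity)).1 (hge.trans hCle)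
  linarith

/-- **`TypeITraceScarL3` at unit viscosity, in the class «terminal-layer energy below `√σ`» — pressure
clause discharged** (item-shaped corollary of `isBackwardBoundedAt_of_terminalLayerDecay_unit`): item
18385's binders at `ν = 1` + class (a) ∧ (b) at `x₀` ⇒ the item's conclusion at `x₀` (vacuously: `(T,x₀)`
is then not backward singular).  Twin of `typeITraceScarL3_unitViscosity_of_layerDecay` (nsreg-p2 g30,
plate t34) WITHOUT clause (c) `p ∈ L^{3/2}(Q_R)`.
[cite: Seregin2014, Ch. 6 Prop. 3.11 (i); Seregin2020, (2.9); Tao2011, Lemma 4.1 (i)] -/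
theorem typeITraceScarL3_unitViscosity_of_terminalLayerDecay :
    ∀ T : ℝ, 0 < T →
    ∀ (u : ℝ → (EuclideanSpace ℝ (Fin 3)) → (EuclideanSpace ℝ (Fin 3)))
      (p : ℝ → (EuclideanSpace ℝ (Fin 3)) → ℝ),
      IsClassicalNSSolutionOn (Set.Ico 0 T) 1 0 u p →
      IsLerayHopfOn T 1 0 (u 0) u →
      HasRapidSpatialDecay (u 0) →
      IsTypeIBlowup u T →
      ∀ x₀ : (EuclideanSpace ℝ (Fin 3)),
        -- the class (a) + (b): gradient companion and the terminal-layer dial below `√σ`; NO clause (c)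
        (∃ ρ Cg T₀ : ℝ, 0 < ρ ∧ 0 < Cg ∧ T₀ < T ∧
          (∀ t ∈ Ioo T₀ T, ∀ x ∈ ball x₀ ρ, ∀ y ∈ ball x₀ (2 * ρ),
            ‖u t x‖ - ‖u t y‖ ≤ Cg / (T - t) * dist y x) ∧
          (∀ ε : ℝ, 0 < ε → ∃ τ : ℝ, 0 < τ ∧ τ ≤ 1 ∧ ∃ l₁ : ℝ, 0 < l₁ ∧
            ∀ l : ℝ, 0 < l → l ≤ l₁ → ∀ x ∈ ball x₀ ρ,
              ∫⁻ y in ball x l, ‖u (T - τ ^ 2 * l ^ 2) y‖ₑ ^ 2 ≤ ENNReal.ofReal (ε * τ * l))) →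
        (∀ r : ℝ, 0 < r → eLpNorm (Function.uncurry u) ⊤
          (volume.restrict (parabolicCylinder r (T, x₀))) = ⊤) →
        ∀ ρ' : ℝ, 0 < ρ' → ¬ MemLp (u T) 3 (volume.restrict (ball x₀ ρ')) := by
  intro T hT u p hcl hLH _hdec hTI x₀ hclass hsing ρ' _hρ' _hL3
  obtain ⟨ρ, Cg, T₀, hρ, hCg, hT₀, hlip, hlayer⟩ := hclass
  exact not_isBackwardBoundedAt_of_forall_eLpNorm_top hsing
    (isBackwardBoundedAt_of_terminalLayerDecay_unit hT hcl hLH hTI hρ hCg hT₀ hlip hlayer)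

/-- **The same criterion with the Lipschitz companion discharged onto a scaled pressure-oscillation
bound — pressure-class clause discharged.**  Class at `x₀`: (a′) below every `(t′,y)`,
`y ∈ B(x₀,2ρ)`, `t′ ∈ (T₀,T)`, some `h(s)` with `∫⁻_{Q_c(t′,y)} |p − h|^{3/2} ≤ (T−t′)·P`,
`c = √(T−t′)` (invariant under `p ↦ p + c(t)`), and (b) the layer dial.  Twin of
`typeITraceScarL3_unitViscosity_of_layerDecay_of_pressureOsc` (plate t34 v1.1) without clause (c).
[cite: Seregin2014, Ch. 6 Prop. 3.11 (i); PineauVicol2026, Lemma 9.2; Tao2011, Lemma 4.1 (i)] -/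
theorem typeITraceScarL3_unitViscosity_of_terminalLayerDecay_of_pressureOsc :
    ∀ T : ℝ, 0 < T →
    ∀ (u : ℝ → (EuclideanSpace ℝ (Fin 3)) → (EuclideanSpace ℝ (Fin 3))) (p : ℝ → (EuclideanSpace ℝ (Fin 3)) → ℝ),
      IsClassicalNSSolutionOn (Set.Ico 0 T) 1 0 u p →
      IsLerayHopfOn T 1 0 (u 0) u →
      HasRapidSpatialDecay (u 0) →
      IsTypeIBlowup u T →
      ∀ x₀ : (EuclideanSpace ℝ (Fin 3)),
        (∃ ρ T₀ : ℝ, ∃ P : ℝ≥0, 0 < ρ ∧ T₀ < T ∧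
          (∀ t' ∈ Ioo T₀ T, ∀ y ∈ ball x₀ (2 * ρ), ∃ h : ℝ → ℝ,
            LocallyIntegrableOn (fun w : ℝ × (EuclideanSpace ℝ (Fin 3)) => h w.1)
              (parabolicCylinder (Real.sqrt (T - t')) (t', y)) volume ∧
            ∫⁻ w in parabolicCylinder (Real.sqrt (T - t')) (t', y),
                ‖p w.1 w.2 - h w.1‖ₑ ^ (3 / 2 : ℝ) ≤ ENNReal.ofReal (T - t') * P) ∧
          (∀ ε : ℝ, 0 < ε → ∃ τ : ℝ, 0 < τ ∧ τ ≤ 1 ∧ ∃ l₁ : ℝ, 0 < l₁ ∧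
            ∀ l : ℝ, 0 < l → l ≤ l₁ → ∀ x ∈ ball x₀ ρ,
              ∫⁻ y in ball x l, ‖u (T - τ ^ 2 * l ^ 2) y‖ₑ ^ 2 ≤ ENNReal.ofReal (ε * τ * l))) →
        (∀ r : ℝ, 0 < r → eLpNorm (Function.uncurry u) ⊤
          (volume.restrict (parabolicCylinder r (T, x₀))) = ⊤) →
        ∀ ρ' : ℝ, 0 < ρ' → ¬ MemLp (u T) 3 (volume.restrict (ball x₀ ρ')) := by
  intro T hT u p hcl hLH hdec hTI x₀ hclass hsing ρ' hρ'
  obtain ⟨ρ, T₀, P, hρ, hT₀, hosc, hlayer⟩ := hclass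
  obtain ⟨Cg, T₁, hCg, hT₁, hlip⟩ :=
    lipschitzCompanion_of_typeI_of_pressureOsc hT hcl hTI (x₀ := x₀) (ρ := ρ) hT₀ hosc
  exact typeITraceScarL3_unitViscosity_of_terminalLayerDecay T hT u p hcl hLH hdec hTI x₀
    ⟨ρ, Cg, T₁, hρ, hCg, hT₁, hlip, hlayer⟩ hsing ρ' hρ'

end Summit.NavierStokesRegularity.NavierStokesRegularity.Theorems.TypeITraceScarL3

end
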